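import Summits.QuantumFields.BalabanUV.Beta.FP.TorusCompositeSliceOneShot
import Summits.QuantumFields.BalabanUV.Beta.FP.TorusCompositeObjectsG

/-!
# `BalabanUV.Beta.FP.TorusCompositeSliceOneShotG` — road «FP» for binder row D1, ROUTE T, (β1) re-basing (R-D1-g52-1 l.56283; R-FP-69 (b) l.56319; leaf-06 g32
# W-2 l.56339, item G-2): **OPTION (α)'s `hTW` WITH THE COMPOSITE COVARIANCE ROW DISPLAYED** — the matrix-generic core of `TorusCompositeSliceOneShot.torus_hTW_oneShot_tower`
# (leaf-06 g25) and its (0.4)-SYMMETRISED spelling; NO landed byte moved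

WHAT.  `torus_hTW_oneShot_tower` proves `(fromRows (τ₂ * Q₁₀) τ₁ * W₀).det ≠ 0` for `τ₁ := bigP …` (the one-shot comb slice — comb GEOMETRY, kernel-free),
`τ₂ := combF …`, `W₀ := towerGen …` and `Q₁₀ := compRows …` from FOUR ingredients, three of them kernel-free (`TorusCompositeUnimodular.det_bigP_mul_towerGen_ne_zero`,
`TorusCompositeSlice.det_combF_mul_smul_tgrad_res_ne_zero`, `NestedStepLawOneShotLetters.det_nestedSlice_mul_gauge_ne_zero`) and ONE kernel-bearing: leaf-02's ROOTED
c0 `compRows_mul_towerGen_succ` AT THE TOP DEPTH ONLY.  So the theorem holds for ANY top block `Q₁₀` obeying c0 — §1 **`torus_hTW_oneShot_tower_of_c0`**: `Q₁₀` a FREE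
matrix, `hc0 : Q₁₀ * towerGen Lc M′ rs (n+1) = fromCols (σ • D̄) 0` and `hσ : σ ≠ 0` DISPLAYED, everything else VERBATIM (the rooted theorem is the instance
`Q₁₀ := compRows …`, `hc0 := compRows_mul_towerGen_succ …`, not re-stated); §2 **`torus_hTW_oneShot_towerSym`**: the spelling `hQ₁₀ : Q₁₀ = compRowsSym Lc M′ lev rs (n+1)`
(`TorusCompositeObjectsG`) with leaf-02's sym c0 at depth `n` displayed (`hc0`; R-D1-g52-1 (3)(c) → leaf-02).  [folklore] linear algebra BY NAME; no `def`, no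
`def … : Prop`, nothing cited, 0 sorry; nothing of the dictionary ∕ Bałaban's asserted (the presentation is the ROW's ruling; the sym c0 is leaf-02's theorem).

HONEST DEPENDENCY (page 1, mandatory): continuum YM on T⁴ ⇐ BetaPertH ∧ nine spine estimates (0/9 proved); BetaPertH ⇐ (D1) ∧ (D4) ∧ CAP+tail;
G-an2-4 gates asym, D1 and NE2/3/4.  HONEST FRAMING (cell contract, verbatim): «discharging `BetaPertH` makes Bałaban's UV stability UNCONDITIONAL —
a real constructive-QFT result; it is NOT the continuum limit and NOT the Clay problem.»  ABSOLUTE RULE (cell charter, verbatim): «No internally-minted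
statement may enter as a cited fact. Every hypothesis is either kernel-proved in this package or a verbatim quotation of a PUBLISHED theorem with page
reference. The manuscript(s) under audit are NOT citable for their own disputed steps — they are the thing under adjudication; programme-internal
(2001/route/tribunal) claims are never citable.»  0 estimates; 0∕4 row-D1 binders (hW, hR, D1Tel, D1Rep); NOT (C1), NOT (T-ID)∕(T-β) complete, NOT SDF,
NOT D1, NOT BetaPertH, NOT continuum, NOT Clay.  D1 formalisation swarm LEAF PROVER 06 (b2b-balaban-beta-d1-formalise-leaf-06 gen 32), 2026-08-24.
No existing file touched.
-/

noncomputable section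

open scoped BigOperators

namespace Summit.QuantumFields.BalabanUV.Beta.FP.TorusCompositeSliceOneShotG

open Matrix Finset
open Literature.MathematicalPhysics.QuantumFieldTheory.Balaban1983to89
open Literature.MathematicalPhysics.QuantumFieldTheory.Balaban1983to89.Beta
open B5Prop11Plancherel (fine)
open B6Lemma24Torus (pbox)
open AffineAveraging (Site box toSite)
open OneStepResolventKernel (Fib)
open Summit.QuantumFields.BalabanUV.Beta.BorderedHessian (stepScale)
open Summit.QuantumFields.BalabanUV.Beta.FP.KernelPeriodisationFib (Idx)
open Summit.QuantumFields.BalabanUV.Beta.FP.TorusGaugeCovariance (tgrad)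
open Summit.QuantumFields.BalabanUV.Beta.FP.TorusGaugeCovarianceCoarse (tgradBlock)
open Summit.QuantumFields.BalabanUV.Beta.FP.TorusCombRows (Res)
open Summit.QuantumFields.BalabanUV.Beta.FP.NestedStepLawOneShotLetters (det_nestedSlice_mul_gauge_ne_zero)
open Summit.QuantumFields.BalabanUV.Beta.FP.NestedStepLawTorusInstance (dvd_fine)
open Summit.QuantumFields.BalabanUV.Beta.FP.TorusCompositeObjects (towerTorus towerTorus_fine_eq_fine bigRatio pboxCongr combF NParam bigP towerGen)
open Summit.QuantumFields.BalabanUV.Beta.FP.TorusCompositeObjectsG (compRowsSym)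
open Summit.QuantumFields.BalabanUV.Beta.FP.TorusCompositeUnimodular (det_bigP_mul_towerGen_ne_zero)
open Summit.QuantumFields.BalabanUV.Beta.FP.TorusCompositeSlice (det_combF_mul_smul_tgrad_res_ne_zero prod_stepScale_mul_card_ne_zero)
open Summit.QuantumFields.BalabanUV.Beta.GAN24.FineReadoutCauchyFrame (toSite_mem_range)

variable {d : ℕ} (M' : Fin (d + 1) → ℕ) [∀ μ, NeZero (M' μ)] (Lc : ℕ) [NeZero Lc] (lev : ℕ → ℕ) (rs : ℕ → (Fin (d + 1) → ℕ)) (n : ℕ)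

/-! ## §1 Option (α)'s `hTW` for ANY top composite block obeying the covariance row `c0` -/

/-- [folklore] **`torus_hTW_oneShot_tower_of_c0` — `(fromRows (τ₂ * Q₁₀) τ₁ * W₀).det ≠ 0` FOR ANY TOP BLOCK `Q₁₀` WITH THE COVARIANCE ROW `c0`**: `τ₁ := bigP Lc
(fine Lc M′) (rs ∘ succ) _ n`, `τ₂ := combF Lc M′ (rs 0)`, `W₀ := towerGen Lc M′ rs (n+1)` as in `TorusCompositeSliceOneShot.torus_hTW_oneShot_tower`, and `hc0 :
Q₁₀ * towerGen Lc M′ rs (n+1) = fromCols (σ • D̄) 0` with `σ ≠ 0` DISPLAYED (leaf-02's `compRows_mul_towerGen_succ` shape, `σ := σ_{n+1}`, for the rooted block; its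
sym twin for `compRowsSym`).  The landed proof VERBATIM with c0 ↦ `hc0`. -/
theorem torus_hTW_oneShot_tower_of_c0 (hrs : ∀ k, rs k ∈ box (d + 1) Lc) (hM' : ∀ i, Lc ∣ M' i)
    (Q₁₀ : Matrix (↥(pbox M') × Fin (d + 1)) (↥(pbox (towerTorus Lc M' (n + 1))) × Fin (d + 1)) ℝ) {σ : ℝ} (hσ : σ ≠ 0)
    (hc0 : Q₁₀ * towerGen Lc M' rs (n + 1)
      = Matrix.fromCols
          (σ • (tgrad M').submatrix (fun a : ↥(pbox M') × Fin (d + 1) => ((a.1, Sum.inl a.2) : Idx M' (Fib d)))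
            (fun t : Res (toSite (rs 0)) Lc M' => (t.1 : ↥(pbox M'))))
          (0 : Matrix (↥(pbox M') × Fin (d + 1)) (NParam Lc (fine Lc M') (fun k => rs (k + 1)) n) ℝ))
    {τ₁ : Matrix (NParam Lc (fine Lc M') (fun k => rs (k + 1)) n) (↥(pbox (towerTorus Lc M' (n + 1))) × Fin (d + 1)) ℝ}
    (hτ₁ : τ₁ = bigP Lc (fine Lc M') (fun k => rs (k + 1)) (fun k => toSite_mem_range (hrs (k + 1))) n)
    {τ₂ : Matrix (Res (toSite (rs 0)) Lc M') (↥(pbox M') × Fin (d + 1)) ℝ} (hτ₂ : τ₂ = combF Lc M' (rs 0))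
    {W₀ : Matrix (↥(pbox (towerTorus Lc M' (n + 1))) × Fin (d + 1)) (NParam Lc M' rs (n + 1)) ℝ} (hW₀ : W₀ = towerGen Lc M' rs (n + 1)) :
    (Matrix.fromRows (τ₂ * Q₁₀) τ₁ * W₀).det ≠ 0 := by
  subst hτ₁ hτ₂ hW₀
  exact det_nestedSlice_mul_gauge_ne_zero
    (bigP Lc (fine Lc M') (fun k => rs (k + 1)) (fun k => toSite_mem_range (hrs (k + 1))) n) (combF Lc M' (rs 0)) Q₁₀
    (towerGen Lc (fine Lc M') (fun k => rs (k + 1)) n)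
    ((tgradBlock M' (bigRatio Lc n)).submatrix
      (fun b : ↥(pbox (towerTorus Lc (fine Lc M') n)) × Fin (d + 1) =>
        ((pboxCongr (towerTorus_fine_eq_fine Lc M' n) b.1, Sum.inl b.2) : Idx (fine (bigRatio Lc n) M') (Fib d)))
      (Subtype.val : Res (toSite (rs 0)) Lc M' → ↥(pbox M')))
    (σ • (tgrad M').submatrix (fun a : ↥(pbox M') × Fin (d + 1) => ((a.1, Sum.inl a.2) : Idx M' (Fib d)))
        (fun t : Res (toSite (rs 0)) Lc M' => (t.1 : ↥(pbox M'))))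
    (Matrix.ext fun a y => congrFun (congrFun hc0 a) (Sum.inr y))
    (Matrix.ext fun a t => congrFun (congrFun hc0 a) (Sum.inl t))
    rfl rfl
    (abs_ne_zero.mpr (det_bigP_mul_towerGen_ne_zero Lc (fine Lc M') (fun k => rs (k + 1)) (fun k => toSite_mem_range (hrs (k + 1))) (dvd_fine M') n))
    (abs_ne_zero.mpr (det_combF_mul_smul_tgrad_res_ne_zero Lc M' (hrs 0) hM' hσ))

/-! ## §2 The (0.4)-symmetrised spelling (leaf-02's sym `c0` at the top depth displayed) -/

/-- [folklore] **`torus_hTW_oneShot_towerSym`** — option (α)'s `hTW` for the (0.4)-symmetrised composite `Q₁₀ := compRowsSym Lc M′ lev rs (n+1)`, given leaf-02's sym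
covariance row at depth `n` (`hc0`, `σ_{n+1} = ∏_{i<n+1} stepScale d Lc (lev (i+1)) · #B`); binders `hQ₁₀ hτ₁ hτ₂ hW₀` as in the rooted theorem. -/
theorem torus_hTW_oneShot_towerSym (hrs : ∀ k, rs k ∈ box (d + 1) Lc) (hM' : ∀ i, Lc ∣ M' i)
    (hc0 : compRowsSym Lc M' lev rs (n + 1) * towerGen Lc M' rs (n + 1)
      = Matrix.fromCols
          ((∏ i ∈ range (n + 1), (stepScale d Lc (lev (i + 1)) * ((box (d + 1) Lc).card : ℝ))) •
            (tgrad M').submatrix (fun a : ↥(pbox M') × Fin (d + 1) => ((a.1, Sum.inl a.2) : Idx M' (Fib d))) (fun t : Res (toSite (rs 0)) Lc M' => (t.1 : ↥(pbox M'))))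
          (0 : Matrix (↥(pbox M') × Fin (d + 1)) (NParam Lc (fine Lc M') (fun k => rs (k + 1)) n) ℝ))
    {Q₁₀ : Matrix (↥(pbox M') × Fin (d + 1)) (↥(pbox (towerTorus Lc M' (n + 1))) × Fin (d + 1)) ℝ}
    {τ₁ : Matrix (NParam Lc (fine Lc M') (fun k => rs (k + 1)) n) (↥(pbox (towerTorus Lc M' (n + 1))) × Fin (d + 1)) ℝ}
    (hQ₁₀ : Q₁₀ = compRowsSym Lc M' lev rs (n + 1))
    (hτ₁ : τ₁ = bigP Lc (fine Lc M') (fun k => rs (k + 1)) (fun k => toSite_mem_range (hrs (k + 1))) n)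
    {τ₂ : Matrix (Res (toSite (rs 0)) Lc M') (↥(pbox M') × Fin (d + 1)) ℝ} (hτ₂ : τ₂ = combF Lc M' (rs 0))
    {W₀ : Matrix (↥(pbox (towerTorus Lc M' (n + 1))) × Fin (d + 1)) (NParam Lc M' rs (n + 1)) ℝ} (hW₀ : W₀ = towerGen Lc M' rs (n + 1)) :
    (Matrix.fromRows (τ₂ * Q₁₀) τ₁ * W₀).det ≠ 0 := by
  subst hQ₁₀
  exact torus_hTW_oneShot_tower_of_c0 M' Lc rs n hrs hM' _ (prod_stepScale_mul_card_ne_zero (d := d) Lc lev (n + 1)) hc0 hτ₁ hτ₂ hW₀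

end Summit.QuantumFields.BalabanUV.Beta.FP.TorusCompositeSliceOneShotG

end
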